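/-
Copyright (c) 2026 the pub-hodgecm-mathlib formalisation cell (harness21).  Prover seat hodgecm-mathlib-K2E4-p07 (g2),
Track B «K2-LIT» ∕ h413, unit «FinGermConstants» of the line `K2_E4_SingularTransferKappaSign`, socket #7R
`K2E4SingularTransferKappaSign.FinGermConstants.sig_K2E3GermConstantRegularHR` (ED. 4), STEP (i) of its non-split residue: HARISH-CHANDRA DESCENT AT THE CENTRAL
SINGULAR POINT WITH THE WITNESS AND ITS VALUE — `ψ_ε := ψ_M ∘ θ` for `ψ = 1_V`, `ψ_ε(ε_H) ≠ 0`.  2026-09-03.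
-/
import Literature.NumberTheory.Rogawski1990.LocalTransferCentralSingularDescentCM                    -- ★ p842098: the descent whose proof is replayed here (all its ★ bricks come with it)
import Summits.HodgeConjecture.HodgeConjecture.Theorems.K2E3GermConstantRegularHRDescentValue      -- ★ p854931 (K2E4-p07 (g0)): `descended_indicator_ne_zero_of_fiberIntegral`
import HarnessLib

/-!
# K2_E4 road (h413 = stmt-HodgeConjecture-24833), socket #7R `sig_K2E3GermConstantRegularHR`, non-split residue STEP (i):
# the descended function `ψ_ε = ψ_M ∘ θ` of `ψ = 1_V` (`V ∋ ε` compact open) — descent identity near `ε_H` AND `ψ_ε(ε_H) ≠ 0`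

Cell `pub/hodgecm-mathlib` (D-0151), Track B; socket **`sig_K2E3GermConstantRegularHR`** (FinGermConstants ED. 3∕4 :309, R-twin of #7; OWNER K2E3, base K2E4-p07).
★ `LocalTransferCentralSingularDescentCM.exists_nhds_classOrbitalIntegral_dock_eq_of_isLocSmooth` (p842098) proves, for every `ψ ∈ C_c^∞(G′_v)`, the EXISTENCE of a
stably saturated `B ∈ 𝓝 ε_H` and of `ψ_ε ∈ C_c^∞(H_v)` with `Φ(⟦θ h⟧, ψ; m_G) = Φ(⟦h⟧, ψ_ε; m_H)` for `G`-regular `h ∈ B` — but its `∃ ψ_ε` forgets the witness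
`ψ_ε = ψ_M ∘ θ`, `ψ_M(m) = ∫ β(x) • ψ(x m x⁻¹) dν_{G′}` (`β` Harish-Chandra's cut-off, ★ `ConjugationCutoff`), and with it the VALUE `ψ_ε(ε_H) = ψ_M(ε)`.  The
non-split residue of #7R (K2E4-p07 (g0) census (i), K2/STATUS.md 2026-09-03T21:47:00Z) needs exactly that value: the local transfer near `ε_H` is `φ^H := Δ₀ • φ_ε`
and `φ^H(ε_H) ≠ 0` is `φ_ε(ε_H) ≠ 0`.  THIS FILE replays p842098's proof VERBATIM for the indicator `ψ = 1_V` of a compact open `V ∋ ε` and adds the conjunct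
`ψ_ε(ε_H) ≠ 0`: `θ ε_H = ε` is centralised by `M = Z(ε)`, W2's compactness clause at `(x, h) = (1, ε_H)` (`ε ∈ tsupport 1_V`) puts `1 ∈ C·M`, the cut-off's
normalisation gives `∫_M β(1·k) dρ(k) = 1 ≠ 0`, and ★ p854931 `descended_indicator_ne_zero_of_fiberIntegral` (`β ≥ 0`, `ν_{G′}` positive on opens) concludes.
[Rogawski1990 §8.2 Prop. 8.2.1 (a) p. 118 ⟸ Prop. 8.1.3; HarishChandra1970 Part I §3 Lemmas 19–23; LanglandsShelstad1990Descent §2.4.]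

* **`exists_nhds_classOrbitalIntegral_dock_eq_indicator_apply_ne_zero`** — p842098's binders VERBATIM with `(ψ, hψ)` replaced by `(V, hVc, hVo, hεV)`; conclusion =
  p842098's with `ψ := 1_V` and the extra conjunct `ψε εH ≠ 0`.

HONEST LABEL: HC_CM is proved only modulo the 7 printed citations (2 remaining named inputs: hLiu418 = stmt-HodgeConjecture-24832, h413 =
stmt-HodgeConjecture-24833) until rung 0 closes; this file is a `--supports stmt-HodgeConjecture-24833` helper (step (i) of 4 of #7R's non-split residue) and retires
nothing by itself.
-/

set_option autoImplicit false
set_option linter.dupNamespace false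

noncomputable section

open Set Filter Topology MeasureTheory MeasureTheory.Measure
open scoped Pointwise Matrix

namespace Summit.HodgeConjecture.HodgeConjecture.Cruxes.H413.K2E3GermConstantRegularHRDescentWitness

open Literature.NumberTheory.Rogawski1990
open Literature.NumberTheory.Automorphic Literature.NumberTheory.Automorphic.UnitaryGroup Literature.MeasureTheory.Group
open _root_.NumberField _root_.IsDedekindDomain

section CentralSingularDescentWitness

variable (L : Type) [Field L] [NumberField L] [IsCMField L] (H' : Matrix (Fin 3) (Fin 3) L) (v : HeightOneSpectrum (𝓞 ↥(maximalRealSubfield L)))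

variable [MeasurableSpace ((cmDatum L 3 H').Local v)] [BorelSpace ((cmDatum L 3 H').Local v)] [MeasurableSpace ((cmDatum L 2 (Matrix.of fun i j : Fin 2 => if i.val + j.val + 1 = 2 then (1 : L) else 0)).Local v × (cmDatum L 1 (Matrix.of fun i j : Fin 1 => if i.val + j.val + 1 = 1 then (1 : L) else 0)).Local v)] [BorelSpace ((cmDatum L 2 (Matrix.of fun i j : Fin 2 => if i.val + j.val + 1 = 2 then (1 : L) else 0)).Local v × (cmDatum L 1 (Matrix.of fun i j : Fin 1 => if i.val + j.val + 1 = 1 then (1 : L) else 0)).Local v)]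
  [iG : ∀ γ : ((cmDatum L 3 H').Local v), MeasurableSpace (((cmDatum L 3 H').Local v) ⧸ Subgroup.centralizer ({γ} : Set ((cmDatum L 3 H').Local v)))]
  [bG : ∀ γ : ((cmDatum L 3 H').Local v), BorelSpace (((cmDatum L 3 H').Local v) ⧸ Subgroup.centralizer ({γ} : Set ((cmDatum L 3 H').Local v)))]
  [iH : ∀ a : ((cmDatum L 2 (Matrix.of fun i j : Fin 2 => if i.val + j.val + 1 = 2 then (1 : L) else 0)).Local v × (cmDatum L 1 (Matrix.of fun i j : Fin 1 => if i.val + j.val + 1 = 1 then (1 : L) else 0)).Local v), MeasurableSpace (((cmDatum L 2 (Matrix.of fun i j : Fin 2 => if i.val + j.val + 1 = 2 then (1 : L) else 0)).Local v × (cmDatum L 1 (Matrix.of fun i j : Fin 1 => if i.val + j.val + 1 = 1 then (1 : L) else 0)).Local v) ⧸ Subgroup.centralizer ({a} : Set ((cmDatum L 2 (Matrix.of fun i j : Fin 2 => if i.val + j.val + 1 = 2 then (1 : L) else 0)).Local v × (cmDatum L 1 (Matrix.of fun i j : Fin 1 => if i.val + j.val + 1 = 1 then (1 : L) else 0)).Local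 v)))]
  [bH : ∀ a : ((cmDatum L 2 (Matrix.of fun i j : Fin 2 => if i.val + j.val + 1 = 2 then (1 : L) else 0)).Local v × (cmDatum L 1 (Matrix.of fun i j : Fin 1 => if i.val + j.val + 1 = 1 then (1 : L) else 0)).Local v), BorelSpace (((cmDatum L 2 (Matrix.of fun i j : Fin 2 => if i.val + j.val + 1 = 2 then (1 : L) else 0)).Local v × (cmDatum L 1 (Matrix.of fun i j : Fin 1 => if i.val + j.val + 1 = 1 then (1 : L) else 0)).Local v) ⧸ Subgroup.centralizer ({a} : Set ((cmDatum L 2 (Matrix.of fun i j : Fin 2 => if i.val + j.val + 1 = 2 then (1 : L) else 0)).Local v × (cmDatum L 1 (Matrix.of fun i j : Fin 1 => if i.val + j.val + 1 = 1 then (1 : L) else 0)).Local v)))]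

set_option maxHeartbeats 800000 in
/-- **Harish-Chandra descent at the central singular point `ε_H = (a·1₂, u)` read through the central dock `θ`, WITH THE WITNESS'S VALUE**: for the indicator
`ψ = 1_V` of a compact open `V ∋ ε` there are a stably saturated `B ∈ 𝓝 ε_H` and `ψ_ε ∈ C_c^∞(H_v)` with `ψ_ε(ε_H) ≠ 0` and
`Φ(⟦θ h⟧, 1_V; mG) = Φ(⟦h⟧, ψ_ε; mH)` for all `G`-regular `h ∈ B` (canonical `mG`, `mH`).  The proof is ★ p842098's, token for token, with `ψ_ε := ψ_M ∘ θ`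
kept in hand; the value is ★ p854931 at `x = 1 ∈ C·Z(ε)`.  See the module docstring.
[cite: Rogawski1990, §8.2 Prop. 8.2.1 (a) pp. 112–113, 118; §4.3 (4.3.1) p. 43] [cite: HarishChandra1970, Part I §3 Lemmas 19–23] [cite: LanglandsShelstad1990Descent, §2.4] -/
theorem exists_nhds_classOrbitalIntegral_dock_eq_indicator_apply_ne_zero
    (hH' : (H'.map (cmConjRingHom L))ᵀ = H') (hdet' : H'.det ≠ 0)
    (w : PlacesOver L v) (hw : IsCMField.complexConj L • w.1 = w.1)
    (νH : Measure ((cmDatum L 2 (Matrix.of fun i j : Fin 2 => if i.val + j.val + 1 = 2 then (1 : L) else 0)).Local v × (cmDatum L 1 (Matrix.of fun i j : Fin 1 => if i.val + j.val + 1 = 1 then (1 : L) else 0)).Local v)) [νH.IsHaarMeasure] [νH.IsMulRightInvariant]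
    (νG : Measure ((cmDatum L 3 H').Local v)) [νG.IsHaarMeasure] [νG.IsMulRightInvariant]
    {mH : OrbitalMeasureFamily ((cmDatum L 2 (Matrix.of fun i j : Fin 2 => if i.val + j.val + 1 = 2 then (1 : L) else 0)).Local v × (cmDatum L 1 (Matrix.of fun i j : Fin 1 => if i.val + j.val + 1 = 1 then (1 : L) else 0)).Local v)} {mG : OrbitalMeasureFamily ((cmDatum L 3 H').Local v)}
    (hmH : mH.IsCanonical (IsLocalGRegular L v) νH)
    (hmG : mG.IsCanonical (fun γ => IsRegularElt (γ.val : GL (Fin 3) (LocalRing L v))) νG)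
    (εH : ((cmDatum L 2 (Matrix.of fun i j : Fin 2 => if i.val + j.val + 1 = 2 then (1 : L) else 0)).Local v × (cmDatum L 1 (Matrix.of fun i j : Fin 1 => if i.val + j.val + 1 = 1 then (1 : L) else 0)).Local v)) (a : LocalRing L v)
    (ha : (εH.1.val.val : Matrix (Fin 2) (Fin 2) (LocalRing L v)) = a • (1 : Matrix (Fin 2) (Fin 2) (LocalRing L v)))
    (hu : (εH.2.val.val : Matrix (Fin 1) (Fin 1) (LocalRing L v)) 0 0 ≠ a)
    (ε : ((cmDatum L 3 H').Local v)) (y : GL (Fin 3) (LocalRing L v)) (θ : ((cmDatum L 2 (Matrix.of fun i j : Fin 2 => if i.val + j.val + 1 = 2 then (1 : L) else 0)).Local v × (cmDatum L 1 (Matrix.of fun i j : Fin 1 => if i.val + j.val + 1 = 1 then (1 : L) else 0)).Local v) ≃ₜ* ↥(Subgroup.centralizer ({ε} : Set ((cmDatum L 3 H').Local v)))) (hθε : (θ εH).1 = ε)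
    (hθ : ∀ z : ((cmDatum L 2 (Matrix.of fun i j : Fin 2 => if i.val + j.val + 1 = 2 then (1 : L) else 0)).Local v × (cmDatum L 1 (Matrix.of fun i j : Fin 1 => if i.val + j.val + 1 = 1 then (1 : L) else 0)).Local v), (((θ z).1).val : GL (Fin 3) (LocalRing L v)) = y * ((endoEmbLocal L v z).val : GL (Fin 3) (LocalRing L v)) * y⁻¹)
    {V : Set ((cmDatum L 3 H').Local v)} (hVc : IsCompact V) (hVo : IsOpen V) (hεV : ε ∈ V) :
    ∃ B ∈ 𝓝 εH, (∀ h ∈ B, ∀ h' : ((cmDatum L 2 (Matrix.of fun i j : Fin 2 => if i.val + j.val + 1 = 2 then (1 : L) else 0)).Local v × (cmDatum L 1 (Matrix.of fun i j : Fin 1 => if i.val + j.val + 1 = 1 then (1 : L) else 0)).Local v), IsLocalStablyConjH L v h h' → h' ∈ B) ∧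
      ∃ ψε : ((cmDatum L 2 (Matrix.of fun i j : Fin 2 => if i.val + j.val + 1 = 2 then (1 : L) else 0)).Local v × (cmDatum L 1 (Matrix.of fun i j : Fin 1 => if i.val + j.val + 1 = 1 then (1 : L) else 0)).Local v) → ℂ, IsLocSmooth ψε ∧ ψε εH ≠ 0 ∧
        ∀ h ∈ B, IsLocalGRegular L v h →
          classOrbitalIntegral mG (V.indicator fun _ => (1 : ℂ)) (ConjClasses.mk ((θ h : ↥(Subgroup.centralizer ({ε} : Set ((cmDatum L 3 H').Local v)))) : ((cmDatum L 3 H').Local v))) = classOrbitalIntegral mH ψε (ConjClasses.mk h) := by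
  classical
  -- (0) the test function `ψ := 1_V` (compact open `V ∋ ε`): locally constant with compact support
  set ψ : ((cmDatum L 3 H').Local v) → ℂ := V.indicator fun _ => (1 : ℂ) with hψdef
  have hψ : IsLocSmooth ψ := isLocSmooth_indicator hVo hVc.isClosed hVc
  have hψlc : IsLocallyConstant ψ := ((isLocSmooth_iff ψ).1 hψ).1
  have hψs : HasCompactSupport ψ := ((isLocSmooth_iff ψ).1 hψ).2
  have hψc : Continuous ψ := hψlc.continuous
  have hεt : ε ∈ tsupport ψ := subset_tsupport ψ (by
    rw [Function.mem_support, hψdef, Set.indicator_of_mem hεV]; exact one_ne_zero)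
  -- (1) ★ W2: the stably saturated window `B` and, for `Ω := tsupport ψ`, the compact `C`
  obtain ⟨B, hB, hBsat, hBC⟩ :=
    exists_nhds_stablySaturated_conj_mem_imp_mem_mul_centralizer L H' hH' hdet' w hw εH a ha hu ε y θ hθε hθ
  obtain ⟨C, hCc, hC⟩ := hBC (tsupport ψ) hψs
  -- (2) `M := Z(ε)` closed, locally compact; `θ` as a bare group isomorphism `e`; `νM := e_* νH`
  have hMc : IsClosed (((Subgroup.centralizer ({ε} : Set ((cmDatum L 3 H').Local v))) : Subgroup ((cmDatum L 3 H').Local v)) : Set ((cmDatum L 3 H').Local v)) := isClosed_coe_centralizer_singleton ε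
  haveI : LocallyCompactSpace ↥(Subgroup.centralizer ({ε} : Set ((cmDatum L 3 H').Local v))) := hMc.isClosedEmbedding_subtypeVal.locallyCompactSpace
  obtain ⟨e, he, hes, heθ⟩ : ∃ e : ((cmDatum L 2 (Matrix.of fun i j : Fin 2 => if i.val + j.val + 1 = 2 then (1 : L) else 0)).Local v × (cmDatum L 1 (Matrix.of fun i j : Fin 1 => if i.val + j.val + 1 = 1 then (1 : L) else 0)).Local v) ≃* ↥(Subgroup.centralizer ({ε} : Set ((cmDatum L 3 H').Local v))), Continuous e ∧ Continuous e.symm ∧ ∀ z, e z = θ z :=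
    ⟨θ.toMulEquiv, θ.continuous, θ.symm.continuous, fun _ => rfl⟩
  haveI hνM1 : (Measure.map e νH).IsHaarMeasure := MulEquiv.isHaarMeasure_map νH e he hes
  haveI hνM2 : (Measure.map e νH).IsMulRightInvariant := isMulRightInvariant_map_mulEquiv_of_isMulRightInvariant e he.measurable νH
  haveI hνM3 : (Measure.map e νH).IsInvInvariant := isInvInvariant_of_isMulRightInvariant_of_isClosed (Subgroup.centralizer ({ε} : Set ((cmDatum L 3 H').Local v))) hMc (Measure.map e νH)
  -- (3) ★ M1: Harish-Chandra's cut-off `β` for `(C, M, νM)`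
  obtain ⟨β, hβc, hβs, hβ0, hβ1⟩ := exists_continuous_hasCompactSupport_integral_comp_mul_eq_one (Subgroup.centralizer ({ε} : Set ((cmDatum L 3 H').Local v))) hMc (Measure.map e νH) hCc
  -- (4) ★ M2a: `ψ_M` is locally constant with compact support; `ψ_ε := ψ_M ∘ θ`
  have hlcM : IsLocallyConstant (fun m : ↥(Subgroup.centralizer ({ε} : Set ((cmDatum L 3 H').Local v))) => ∫ x, β x • ψ (x * (m : ((cmDatum L 3 H').Local v)) * x⁻¹) ∂νG) := isLocallyConstant_integral_conj νG (Subgroup.centralizer ({ε} : Set ((cmDatum L 3 H').Local v))) hβs hψlc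
  have hcsM : HasCompactSupport (fun m : ↥(Subgroup.centralizer ({ε} : Set ((cmDatum L 3 H').Local v))) => ∫ x, β x • ψ (x * (m : ((cmDatum L 3 H').Local v)) * x⁻¹) ∂νG) := hasCompactSupport_integral_conj νG (Subgroup.centralizer ({ε} : Set ((cmDatum L 3 H').Local v))) hMc hβs hψs
  refine ⟨B, hB, hBsat, (fun z : ((cmDatum L 2 (Matrix.of fun i j : Fin 2 => if i.val + j.val + 1 = 2 then (1 : L) else 0)).Local v × (cmDatum L 1 (Matrix.of fun i j : Fin 1 => if i.val + j.val + 1 = 1 then (1 : L) else 0)).Local v) => ∫ x, β x • ψ (x * ((θ z : ↥(Subgroup.centralizer ({ε} : Set ((cmDatum L 3 H').Local v)))) : ((cmDatum L 3 H').Local v)) * x⁻¹) ∂νG), ?_, ?_, ?_⟩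
  · exact (isLocSmooth_iff _).2 ⟨hlcM.comp_continuous θ.continuous, hcsM.comp_homeomorph θ.toHomeomorph⟩
  · -- THE VALUE AT `ε_H`: `θ ε_H = ε` is central in `M`, `1 ∈ C·M` (take `x = 1`, `h = ε_H` in W2's conclusion: `ε ∈ tsupport ψ`), so the cut-off's
    -- normalisation gives `∫_M β(1·k) dρ = 1 ≠ 0` and ★ p854931 `descended_indicator_ne_zero_of_fiberIntegral` applies.
    have hεB : εH ∈ B := mem_of_mem_nhds hB
    have h1CM : (1 : ((cmDatum L 3 H').Local v)) ∈ C * (((Subgroup.centralizer ({ε} : Set ((cmDatum L 3 H').Local v))) : Subgroup ((cmDatum L 3 H').Local v)) : Set ((cmDatum L 3 H').Local v)) := by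
      refine hC 1 εH hεB ?_
      rw [hθε, one_mul, inv_one, mul_one]
      exact hεt
    obtain ⟨c, hc, k₀, hk₀, hck⟩ := Set.mem_mul.1 h1CM
    have hfib : (∫ k : ↥(Subgroup.centralizer ({ε} : Set ((cmDatum L 3 H').Local v))), β ((1 : ((cmDatum L 3 H').Local v)) * (k : ((cmDatum L 3 H').Local v))) ∂(Measure.map e νH)) ≠ 0 := by
      have h1 := hβ1 c hc ⟨k₀, hk₀⟩
      rw [Subgroup.coe_mk, hck] at h1
      rw [h1]; exact one_ne_zero
    have hval := Summit.HodgeConjecture.HodgeConjecture.Cruxes.H413.K2E3GermConstantRegularHRDescentValue.descended_indicator_ne_zero_of_fiberIntegral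
      νG (Subgroup.centralizer ({ε} : Set ((cmDatum L 3 H').Local v))) (Measure.map e νH) (m := ε)
      (fun k hk => Subgroup.mem_centralizer_singleton_iff.1 hk) hβc hβs hβ0 hVo (x := 1)
      (by rw [one_mul, inv_one, mul_one]; exact hεV) hfib
    change (∫ x, β x • ψ (x * ((θ εH : ↥(Subgroup.centralizer ({ε} : Set ((cmDatum L 3 H').Local v)))) : ((cmDatum L 3 H').Local v)) * x⁻¹) ∂νG) ≠ 0
    rw [hθε]
    exact hval
  -- (5) the identity at a `G`-regular `h ∈ B`, run at the representative `γ_H := out ⟦h⟧`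
  intro h hh hreg
  have hoq : ConjClasses.mk (Quotient.out (ConjClasses.mk h)) = ConjClasses.mk h := Quotient.out_eq (ConjClasses.mk h)
  have hconj : IsConj (Quotient.out (ConjClasses.mk h)) h := ConjClasses.mk_eq_mk_iff_isConj.1 hoq
  have hst : IsLocalStablyConjH L v h (Quotient.out (ConjClasses.mk h)) := isStablyConjH_of_isConj hconj.symm
  have hγHB : (Quotient.out (ConjClasses.mk h)) ∈ B := hBsat h hh (Quotient.out (ConjClasses.mk h)) hst
  have hregH : IsLocalGRegular L v (Quotient.out (ConjClasses.mk h)) := isGRegular_of_isStablyConjH _ _ _ _ hst hreg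
  -- the canonical torus measure `t_H` at `⟦h⟧` on the `H`-side
  obtain ⟨tH, htH1, htH2, htHcore, hmHc⟩ := hmH (ConjClasses.mk h) hregH
  have hZHc : IsClosed (((Subgroup.centralizer ({(Quotient.out (ConjClasses.mk h))} : Set ((cmDatum L 2 (Matrix.of fun i j : Fin 2 => if i.val + j.val + 1 = 2 then (1 : L) else 0)).Local v × (cmDatum L 1 (Matrix.of fun i j : Fin 1 => if i.val + j.val + 1 = 1 then (1 : L) else 0)).Local v))) : Subgroup ((cmDatum L 2 (Matrix.of fun i j : Fin 2 => if i.val + j.val + 1 = 2 then (1 : L) else 0)).Local v × (cmDatum L 1 (Matrix.of fun i j : Fin 1 => if i.val + j.val + 1 = 1 then (1 : L) else 0)).Local v)) : Set ((cmDatum L 2 (Matrix.of fun i j : Fin 2 => if i.val + j.val + 1 = 2 then (1 : L) else 0)).Local v × (cmDatum L 1 (Matrix.of fun i j : Fin 1 => if i.val + j.val + 1 = 1 then (1 : L) else 0)).Local v)) := isClosed_coe_centralizer_singleton _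
  haveI : LocallyCompactSpace ↥(Subgroup.centralizer ({(Quotient.out (ConjClasses.mk h))} : Set ((cmDatum L 2 (Matrix.of fun i j : Fin 2 => if i.val + j.val + 1 = 2 then (1 : L) else 0)).Local v × (cmDatum L 1 (Matrix.of fun i j : Fin 1 => if i.val + j.val + 1 = 1 then (1 : L) else 0)).Local v))) := hZHc.isClosedEmbedding_subtypeVal.locallyCompactSpace
  -- (c4) `γ″ := θ γ_H` is regular in `GL₃`
  have hregG : IsRegularElt ((((e (Quotient.out (ConjClasses.mk h)) : ↥(Subgroup.centralizer ({ε} : Set ((cmDatum L 3 H').Local v)))) : ((cmDatum L 3 H').Local v))).val : GL (Fin 3) (LocalRing L v)) := by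
    rw [heθ, hθ (Quotient.out (ConjClasses.mk h)), isRegularElt_conj_iff]
    exact hregH
  -- (c1) the centraliser `T := Z_{G′}(γ″)`: commutative and contained in `M`
  have hcommM := commute_of_commute_of_isRegularElt_local L v ((e (Quotient.out (ConjClasses.mk h)) : ↥(Subgroup.centralizer ({ε} : Set ((cmDatum L 3 H').Local v)))) : ((cmDatum L 3 H').Local v)) hregG
  have hval : ∀ s s' : ((cmDatum L 3 H').Local v), s * s' = s' * s ↔ Commute ((s.val : GL (Fin 3) (LocalRing L v)).val) ((s'.val : GL (Fin 3) (LocalRing L v)).val) := by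
    intro s s'
    constructor
    · intro hss'
      exact congrArg (fun g : ((cmDatum L 3 H').Local v) => ((g.val : GL (Fin 3) (LocalRing L v)).val)) hss'
    · intro hc
      exact Subtype.ext (Units.ext hc)
  have hεc : Commute ((ε.val : GL (Fin 3) (LocalRing L v)).val) (((((e (Quotient.out (ConjClasses.mk h)) : ↥(Subgroup.centralizer ({ε} : Set ((cmDatum L 3 H').Local v)))) : ((cmDatum L 3 H').Local v))).val : GL (Fin 3) (LocalRing L v)).val) :=
    ((hval _ _).1 (Subgroup.mem_centralizer_singleton_iff.1 (e (Quotient.out (ConjClasses.mk h))).2)).symm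
  have hTM : ∀ s ∈ (Subgroup.centralizer ({((e (Quotient.out (ConjClasses.mk h)) : ↥(Subgroup.centralizer ({ε} : Set ((cmDatum L 3 H').Local v)))) : ((cmDatum L 3 H').Local v))} : Set ((cmDatum L 3 H').Local v))), s ∈ (Subgroup.centralizer ({ε} : Set ((cmDatum L 3 H').Local v))) := fun s hs =>
    Subgroup.mem_centralizer_singleton_iff.2 ((hval _ _).2
      (hcommM _ _ ((hval _ _).1 (Subgroup.mem_centralizer_singleton_iff.1 hs)) hεc))
  have hTcomm : ∀ s ∈ (Subgroup.centralizer ({((e (Quotient.out (ConjClasses.mk h)) : ↥(Subgroup.centralizer ({ε} : Set ((cmDatum L 3 H').Local v)))) : ((cmDatum L 3 H').Local v))} : Set ((cmDatum L 3 H').Local v))), ∀ s' ∈ (Subgroup.centralizer ({((e (Quotient.out (ConjClasses.mk h)) : ↥(Subgroup.centralizer ({ε} : Set ((cmDatum L 3 H').Local v)))) : ((cmDatum L 3 H').Local v))} : Set ((cmDatum L 3 H').Local v))), s * s' = s' * s := fun s hs s' hs' =>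
    (hval _ _).2 (hcommM _ _ ((hval _ _).1 (Subgroup.mem_centralizer_singleton_iff.1 hs))
      ((hval _ _).1 (Subgroup.mem_centralizer_singleton_iff.1 hs')))
  have hTc : IsClosed (((Subgroup.centralizer ({((e (Quotient.out (ConjClasses.mk h)) : ↥(Subgroup.centralizer ({ε} : Set ((cmDatum L 3 H').Local v)))) : ((cmDatum L 3 H').Local v))} : Set ((cmDatum L 3 H').Local v))) : Subgroup ((cmDatum L 3 H').Local v)) : Set ((cmDatum L 3 H').Local v)) := isClosed_coe_centralizer_singleton _
  have hTMc : IsClosed (((Subgroup.centralizer ({e (Quotient.out (ConjClasses.mk h))} : Set ↥(Subgroup.centralizer ({ε} : Set ((cmDatum L 3 H').Local v))))) : Subgroup ↥(Subgroup.centralizer ({ε} : Set ((cmDatum L 3 H').Local v)))) : Set ↥(Subgroup.centralizer ({ε} : Set ((cmDatum L 3 H').Local v)))) := isClosed_coe_centralizer_singleton _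
  haveI : LocallyCompactSpace ↥(Subgroup.centralizer ({e (Quotient.out (ConjClasses.mk h))} : Set ↥(Subgroup.centralizer ({ε} : Set ((cmDatum L 3 H').Local v))))) := hTMc.isClosedEmbedding_subtypeVal.locallyCompactSpace
  -- `incl : Z_M(γ″) ≃ₜ* T`
  have hmemT : ∀ s : ↥(Subgroup.centralizer ({e (Quotient.out (ConjClasses.mk h))} : Set ↥(Subgroup.centralizer ({ε} : Set ((cmDatum L 3 H').Local v))))), ((s : ↥(Subgroup.centralizer ({ε} : Set ((cmDatum L 3 H').Local v)))) : ((cmDatum L 3 H').Local v)) ∈ (Subgroup.centralizer ({((e (Quotient.out (ConjClasses.mk h)) : ↥(Subgroup.centralizer ({ε} : Set ((cmDatum L 3 H').Local v)))) : ((cmDatum L 3 H').Local v))} : Set ((cmDatum L 3 H').Local v))) := fun s =>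
    Subgroup.mem_centralizer_singleton_iff.2 (by
      have h1 := Subgroup.mem_centralizer_singleton_iff.1 s.2
      exact_mod_cast congrArg ((↑) : ↥(Subgroup.centralizer ({ε} : Set ((cmDatum L 3 H').Local v))) → ((cmDatum L 3 H').Local v)) h1)
  have hmemTM : ∀ s : ↥(Subgroup.centralizer ({((e (Quotient.out (ConjClasses.mk h)) : ↥(Subgroup.centralizer ({ε} : Set ((cmDatum L 3 H').Local v)))) : ((cmDatum L 3 H').Local v))} : Set ((cmDatum L 3 H').Local v))), (⟨(s : ((cmDatum L 3 H').Local v)), hTM s s.2⟩ : ↥(Subgroup.centralizer ({ε} : Set ((cmDatum L 3 H').Local v)))) ∈ (Subgroup.centralizer ({e (Quotient.out (ConjClasses.mk h))} : Set ↥(Subgroup.centralizer ({ε} : Set ((cmDatum L 3 H').Local v))))) := fun s =>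
    Subgroup.mem_centralizer_singleton_iff.2 (Subtype.ext (by
      have h1 := Subgroup.mem_centralizer_singleton_iff.1 s.2
      simpa only [Subgroup.coe_mul] using h1))
  let eT : ↥(Subgroup.centralizer ({e (Quotient.out (ConjClasses.mk h))} : Set ↥(Subgroup.centralizer ({ε} : Set ((cmDatum L 3 H').Local v))))) ≃ₜ* ↥(Subgroup.centralizer ({((e (Quotient.out (ConjClasses.mk h)) : ↥(Subgroup.centralizer ({ε} : Set ((cmDatum L 3 H').Local v)))) : ((cmDatum L 3 H').Local v))} : Set ((cmDatum L 3 H').Local v))) :=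
    { toFun := fun s => ⟨((s : ↥(Subgroup.centralizer ({ε} : Set ((cmDatum L 3 H').Local v)))) : ((cmDatum L 3 H').Local v)), hmemT s⟩
      invFun := fun s => ⟨⟨(s : ((cmDatum L 3 H').Local v)), hTM s s.2⟩, hmemTM s⟩
      left_inv := fun s => rfl
      right_inv := fun s => rfl
      map_mul' := fun s s' => rfl
      continuous_toFun := (continuous_subtype_val.comp continuous_subtype_val).subtype_mk _
      continuous_invFun := ((continuous_subtype_val).subtype_mk _).subtype_mk _ }
  -- the torus measures: `t_M := (θ|)_* t_H` on `Z_M(γ″)`, `t := incl_* t_M` on `T`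
  have hHH' : ∀ g : ((cmDatum L 2 (Matrix.of fun i j : Fin 2 => if i.val + j.val + 1 = 2 then (1 : L) else 0)).Local v × (cmDatum L 1 (Matrix.of fun i j : Fin 1 => if i.val + j.val + 1 = 1 then (1 : L) else 0)).Local v), e g ∈ (Subgroup.centralizer ({e (Quotient.out (ConjClasses.mk h))} : Set ↥(Subgroup.centralizer ({ε} : Set ((cmDatum L 3 H').Local v))))) ↔ g ∈ (Subgroup.centralizer ({(Quotient.out (ConjClasses.mk h))} : Set ((cmDatum L 2 (Matrix.of fun i j : Fin 2 => if i.val + j.val + 1 = 2 then (1 : L) else 0)).Local v × (cmDatum L 1 (Matrix.of fun i j : Fin 1 => if i.val + j.val + 1 = 1 then (1 : L) else 0)).Local v))) := fun g => by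
    rw [Subgroup.mem_centralizer_singleton_iff, Subgroup.mem_centralizer_singleton_iff, ← map_mul, ← map_mul, e.apply_eq_iff_eq]
  haveI htM1 : (Measure.map (subgroupCongrHomeomorph e (Subgroup.centralizer ({(Quotient.out (ConjClasses.mk h))} : Set ((cmDatum L 2 (Matrix.of fun i j : Fin 2 => if i.val + j.val + 1 = 2 then (1 : L) else 0)).Local v × (cmDatum L 1 (Matrix.of fun i j : Fin 1 => if i.val + j.val + 1 = 1 then (1 : L) else 0)).Local v))) (Subgroup.centralizer ({e (Quotient.out (ConjClasses.mk h))} : Set ↥(Subgroup.centralizer ({ε} : Set ((cmDatum L 3 H').Local v))))) hHH' he hes) tH).IsHaarMeasure :=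
    isHaarMeasure_map_subgroupCongrHomeomorph e he hes (Subgroup.centralizer ({(Quotient.out (ConjClasses.mk h))} : Set ((cmDatum L 2 (Matrix.of fun i j : Fin 2 => if i.val + j.val + 1 = 2 then (1 : L) else 0)).Local v × (cmDatum L 1 (Matrix.of fun i j : Fin 1 => if i.val + j.val + 1 = 1 then (1 : L) else 0)).Local v))) (Subgroup.centralizer ({e (Quotient.out (ConjClasses.mk h))} : Set ↥(Subgroup.centralizer ({ε} : Set ((cmDatum L 3 H').Local v))))) hHH' tH
  haveI htM2 : (Measure.map (subgroupCongrHomeomorph e (Subgroup.centralizer ({(Quotient.out (ConjClasses.mk h))} : Set ((cmDatum L 2 (Matrix.of fun i j : Fin 2 => if i.val + j.val + 1 = 2 then (1 : L) else 0)).Local v × (cmDatum L 1 (Matrix.of fun i j : Fin 1 => if i.val + j.val + 1 = 1 then (1 : L) else 0)).Local v))) (Subgroup.centralizer ({e (Quotient.out (ConjClasses.mk h))} : Set ↥(Subgroup.centralizer ({ε} : Set ((cmDatum L 3 H').Local v))))) hHH' he hes) tH).IsInvInvariant :=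
    isInvInvariant_map_subgroupCongrHomeomorph e he hes (Subgroup.centralizer ({(Quotient.out (ConjClasses.mk h))} : Set ((cmDatum L 2 (Matrix.of fun i j : Fin 2 => if i.val + j.val + 1 = 2 then (1 : L) else 0)).Local v × (cmDatum L 1 (Matrix.of fun i j : Fin 1 => if i.val + j.val + 1 = 1 then (1 : L) else 0)).Local v))) (Subgroup.centralizer ({e (Quotient.out (ConjClasses.mk h))} : Set ↥(Subgroup.centralizer ({ε} : Set ((cmDatum L 3 H').Local v))))) hHH' tH
  haveI htT1 : (Measure.map eT (Measure.map (subgroupCongrHomeomorph e (Subgroup.centralizer ({(Quotient.out (ConjClasses.mk h))} : Set ((cmDatum L 2 (Matrix.of fun i j : Fin 2 => if i.val + j.val + 1 = 2 then (1 : L) else 0)).Local v × (cmDatum L 1 (Matrix.of fun i j : Fin 1 => if i.val + j.val + 1 = 1 then (1 : L) else 0)).Local v))) (Subgroup.centralizer ({e (Quotient.out (ConjClasses.mk h))} : Set ↥(Subgroup.centralizer ({ε} : Set ((cmDatum L 3 H').Local v))))) hHH' he hes) tH)).IsHaarMeasure :=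
    MulEquiv.isHaarMeasure_map _ eT.toMulEquiv eT.continuous eT.symm.continuous
  haveI htT2 : (Measure.map eT (Measure.map (subgroupCongrHomeomorph e (Subgroup.centralizer ({(Quotient.out (ConjClasses.mk h))} : Set ((cmDatum L 2 (Matrix.of fun i j : Fin 2 => if i.val + j.val + 1 = 2 then (1 : L) else 0)).Local v × (cmDatum L 1 (Matrix.of fun i j : Fin 1 => if i.val + j.val + 1 = 1 then (1 : L) else 0)).Local v))) (Subgroup.centralizer ({e (Quotient.out (ConjClasses.mk h))} : Set ↥(Subgroup.centralizer ({ε} : Set ((cmDatum L 3 H').Local v))))) hHH' he hes) tH)).IsInvInvariant :=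
    isInvInvariant_map_mulEquiv eT.toMulEquiv eT.continuous.measurable _
  haveI htT3 : (Measure.map eT (Measure.map (subgroupCongrHomeomorph e (Subgroup.centralizer ({(Quotient.out (ConjClasses.mk h))} : Set ((cmDatum L 2 (Matrix.of fun i j : Fin 2 => if i.val + j.val + 1 = 2 then (1 : L) else 0)).Local v × (cmDatum L 1 (Matrix.of fun i j : Fin 1 => if i.val + j.val + 1 = 1 then (1 : L) else 0)).Local v))) (Subgroup.centralizer ({e (Quotient.out (ConjClasses.mk h))} : Set ↥(Subgroup.centralizer ({ε} : Set ((cmDatum L 3 H').Local v))))) hHH' he hes) tH)).IsMulRightInvariant :=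
    isMulRightInvariant_of_forall_comm (Subgroup.centralizer ({((e (Quotient.out (ConjClasses.mk h)) : ↥(Subgroup.centralizer ({ε} : Set ((cmDatum L 3 H').Local v)))) : ((cmDatum L 3 H').Local v))} : Set ((cmDatum L 3 H').Local v))) hTc hTcomm _
  -- normalisation: `t (compactCore T) = 1`
  have hcoreM : (Measure.map (subgroupCongrHomeomorph e (Subgroup.centralizer ({(Quotient.out (ConjClasses.mk h))} : Set ((cmDatum L 2 (Matrix.of fun i j : Fin 2 => if i.val + j.val + 1 = 2 then (1 : L) else 0)).Local v × (cmDatum L 1 (Matrix.of fun i j : Fin 1 => if i.val + j.val + 1 = 1 then (1 : L) else 0)).Local v))) (Subgroup.centralizer ({e (Quotient.out (ConjClasses.mk h))} : Set ↥(Subgroup.centralizer ({ε} : Set ((cmDatum L 3 H').Local v))))) hHH' he hes) tH) (compactCore ↥(Subgroup.centralizer ({e (Quotient.out (ConjClasses.mk h))} : Set ↥(Subgroup.centralizer ({ε} : Set ((cmDatum L 3 H').Local v)))))) = 1 := by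
    let eM : ↥(Subgroup.centralizer ({(Quotient.out (ConjClasses.mk h))} : Set ((cmDatum L 2 (Matrix.of fun i j : Fin 2 => if i.val + j.val + 1 = 2 then (1 : L) else 0)).Local v × (cmDatum L 1 (Matrix.of fun i j : Fin 1 => if i.val + j.val + 1 = 1 then (1 : L) else 0)).Local v))) ≃ₜ* ↥(Subgroup.centralizer ({e (Quotient.out (ConjClasses.mk h))} : Set ↥(Subgroup.centralizer ({ε} : Set ((cmDatum L 3 H').Local v))))) :=
      { (subgroupCongrHomeomorph e (Subgroup.centralizer ({(Quotient.out (ConjClasses.mk h))} : Set ((cmDatum L 2 (Matrix.of fun i j : Fin 2 => if i.val + j.val + 1 = 2 then (1 : L) else 0)).Local v × (cmDatum L 1 (Matrix.of fun i j : Fin 1 => if i.val + j.val + 1 = 1 then (1 : L) else 0)).Local v))) (Subgroup.centralizer ({e (Quotient.out (ConjClasses.mk h))} : Set ↥(Subgroup.centralizer ({ε} : Set ((cmDatum L 3 H').Local v))))) hHH' he hes).toEquiv with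
        map_mul' := fun s s' => Subtype.ext (by
          change e ((s * s' : ↥(Subgroup.centralizer ({(Quotient.out (ConjClasses.mk h))} : Set ((cmDatum L 2 (Matrix.of fun i j : Fin 2 => if i.val + j.val + 1 = 2 then (1 : L) else 0)).Local v × (cmDatum L 1 (Matrix.of fun i j : Fin 1 => if i.val + j.val + 1 = 1 then (1 : L) else 0)).Local v)))) : ((cmDatum L 2 (Matrix.of fun i j : Fin 2 => if i.val + j.val + 1 = 2 then (1 : L) else 0)).Local v × (cmDatum L 1 (Matrix.of fun i j : Fin 1 => if i.val + j.val + 1 = 1 then (1 : L) else 0)).Local v)) = e (s : ((cmDatum L 2 (Matrix.of fun i j : Fin 2 => if i.val + j.val + 1 = 2 then (1 : L) else 0)).Local v × (cmDatum L 1 (Matrix.of fun i j : Fin 1 => if i.val + j.val + 1 = 1 then (1 : L) else 0)).Local v)) * e (s' : ((cmDatum L 2 (Matrix.of fun i j : Fin 2 => if i.val + j.val + 1 = 2 then (1 : L) else 0)).Local v × (cmDatum L 1 (Matrix.of fun i j : Fin 1 => if i.val + j.val + 1 = 1 then (1 : L) else 0)).Local v))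
          rw [Subgroup.coe_mul, map_mul])
        continuous_toFun := (subgroupCongrHomeomorph e (Subgroup.centralizer ({(Quotient.out (ConjClasses.mk h))} : Set ((cmDatum L 2 (Matrix.of fun i j : Fin 2 => if i.val + j.val + 1 = 2 then (1 : L) else 0)).Local v × (cmDatum L 1 (Matrix.of fun i j : Fin 1 => if i.val + j.val + 1 = 1 then (1 : L) else 0)).Local v))) (Subgroup.centralizer ({e (Quotient.out (ConjClasses.mk h))} : Set ↥(Subgroup.centralizer ({ε} : Set ((cmDatum L 3 H').Local v))))) hHH' he hes).continuous
        continuous_invFun := (subgroupCongrHomeomorph e (Subgroup.centralizer ({(Quotient.out (ConjClasses.mk h))} : Set ((cmDatum L 2 (Matrix.of fun i j : Fin 2 => if i.val + j.val + 1 = 2 then (1 : L) else 0)).Local v × (cmDatum L 1 (Matrix.of fun i j : Fin 1 => if i.val + j.val + 1 = 1 then (1 : L) else 0)).Local v))) (Subgroup.centralizer ({e (Quotient.out (ConjClasses.mk h))} : Set ↥(Subgroup.centralizer ({ε} : Set ((cmDatum L 3 H').Local v))))) hHH' he hes).symm.continuous }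
    have hco : ⇑eM = ⇑(subgroupCongrHomeomorph e (Subgroup.centralizer ({(Quotient.out (ConjClasses.mk h))} : Set ((cmDatum L 2 (Matrix.of fun i j : Fin 2 => if i.val + j.val + 1 = 2 then (1 : L) else 0)).Local v × (cmDatum L 1 (Matrix.of fun i j : Fin 1 => if i.val + j.val + 1 = 1 then (1 : L) else 0)).Local v))) (Subgroup.centralizer ({e (Quotient.out (ConjClasses.mk h))} : Set ↥(Subgroup.centralizer ({ε} : Set ((cmDatum L 3 H').Local v))))) hHH' he hes) := rfl
    rw [← Homeomorph.toMeasurableEquiv_coe, MeasurableEquiv.map_apply, Homeomorph.toMeasurableEquiv_coe, ← hco,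
      ← image_compactCore eM, eM.injective.preimage_image, htHcore]
  have hcoreT : (Measure.map eT (Measure.map (subgroupCongrHomeomorph e (Subgroup.centralizer ({(Quotient.out (ConjClasses.mk h))} : Set ((cmDatum L 2 (Matrix.of fun i j : Fin 2 => if i.val + j.val + 1 = 2 then (1 : L) else 0)).Local v × (cmDatum L 1 (Matrix.of fun i j : Fin 1 => if i.val + j.val + 1 = 1 then (1 : L) else 0)).Local v))) (Subgroup.centralizer ({e (Quotient.out (ConjClasses.mk h))} : Set ↥(Subgroup.centralizer ({ε} : Set ((cmDatum L 3 H').Local v))))) hHH' he hes) tH)) (compactCore ↥(Subgroup.centralizer ({((e (Quotient.out (ConjClasses.mk h)) : ↥(Subgroup.centralizer ({ε} : Set ((cmDatum L 3 H').Local v)))) : ((cmDatum L 3 H').Local v))} : Set ((cmDatum L 3 H').Local v)))) = 1 := by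
    have hco : ⇑eT = ⇑eT.toHomeomorph.toMeasurableEquiv := rfl
    rw [hco, MeasurableEquiv.map_apply, ← hco, ← image_compactCore eT, eT.injective.preimage_image, hcoreM]
  -- Borel structure on `M ⧸ Z_M(γ″)`
  letI iq : MeasurableSpace (↥(Subgroup.centralizer ({ε} : Set ((cmDatum L 3 H').Local v))) ⧸ (Subgroup.centralizer ({e (Quotient.out (ConjClasses.mk h))} : Set ↥(Subgroup.centralizer ({ε} : Set ((cmDatum L 3 H').Local v)))))) := borel _
  haveI : BorelSpace (↥(Subgroup.centralizer ({ε} : Set ((cmDatum L 3 H').Local v))) ⧸ (Subgroup.centralizer ({e (Quotient.out (ConjClasses.mk h))} : Set ↥(Subgroup.centralizer ({ε} : Set ((cmDatum L 3 H').Local v)))))) := ⟨rfl⟩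
  -- STEP A: same class
  have hA : ConjClasses.mk ((θ h : ↥(Subgroup.centralizer ({ε} : Set ((cmDatum L 3 H').Local v)))) : ((cmDatum L 3 H').Local v)) = ConjClasses.mk ((e (Quotient.out (ConjClasses.mk h)) : ↥(Subgroup.centralizer ({ε} : Set ((cmDatum L 3 H').Local v)))) : ((cmDatum L 3 H').Local v)) := by
    rw [heθ]
    obtain ⟨c, hc⟩ := isConj_iff.1 hconj.symm
    refine ConjClasses.mk_eq_mk_iff_isConj.2 (isConj_iff.2 ⟨((θ c : ↥(Subgroup.centralizer ({ε} : Set ((cmDatum L 3 H').Local v)))) : ((cmDatum L 3 H').Local v)), ?_⟩)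
    rw [← hc, map_mul, map_mul, map_inv, Subgroup.coe_mul, Subgroup.coe_mul, Subgroup.coe_inv]
  -- STEP B: the canonical member at `⟦γ″⟧` is `νG ∕ t` (★ `classOrbitalIntegral_mk_eq_orbitalIntegral'`)
  have hPG : ∀ g x : ((cmDatum L 3 H').Local v), IsRegularElt (g.val : GL (Fin 3) (LocalRing L v)) → IsRegularElt ((x * g * x⁻¹).val : GL (Fin 3) (LocalRing L v)) := fun g x hg =>
    (isRegularElt_conj_iff (x.val : GL (Fin 3) (LocalRing L v)) (g.val : GL (Fin 3) (LocalRing L v))).2 hg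
  have hB' := hmG.classOrbitalIntegral_mk_eq_orbitalIntegral' hPG hregG
    (Measure.map eT (Measure.map (subgroupCongrHomeomorph e (Subgroup.centralizer ({(Quotient.out (ConjClasses.mk h))} : Set ((cmDatum L 2 (Matrix.of fun i j : Fin 2 => if i.val + j.val + 1 = 2 then (1 : L) else 0)).Local v × (cmDatum L 1 (Matrix.of fun i j : Fin 1 => if i.val + j.val + 1 = 1 then (1 : L) else 0)).Local v))) (Subgroup.centralizer ({e (Quotient.out (ConjClasses.mk h))} : Set ↥(Subgroup.centralizer ({ε} : Set ((cmDatum L 3 H').Local v))))) hHH' he hes) tH)) hcoreT ψ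
  -- STEP C: ★ M3 — descent from `G′_v` to `M = Z(ε)` at `γ″`
  have hO : IsClosed {g : ((cmDatum L 3 H').Local v) | ∃ x : ((cmDatum L 3 H').Local v), x * ((e (Quotient.out (ConjClasses.mk h)) : ↥(Subgroup.centralizer ({ε} : Set ((cmDatum L 3 H').Local v)))) : ((cmDatum L 3 H').Local v)) * x⁻¹ = g} :=
    isClosed_conjClass_local_of_isRegularElt L 3 H' v hH' hdet' ((e (Quotient.out (ConjClasses.mk h)) : ↥(Subgroup.centralizer ({ε} : Set ((cmDatum L 3 H').Local v)))) : ((cmDatum L 3 H').Local v)) hregG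
  have hCM : ∀ x : ((cmDatum L 3 H').Local v), x * ((e (Quotient.out (ConjClasses.mk h)) : ↥(Subgroup.centralizer ({ε} : Set ((cmDatum L 3 H').Local v)))) : ((cmDatum L 3 H').Local v)) * x⁻¹ ∈ tsupport ψ → x ∈ C * (((Subgroup.centralizer ({ε} : Set ((cmDatum L 3 H').Local v))) : Subgroup ((cmDatum L 3 H').Local v)) : Set ((cmDatum L 3 H').Local v)) := fun x hx =>
    hC x (Quotient.out (ConjClasses.mk h)) hγHB (by rwa [heθ] at hx)
  have hC' := orbitalIntegral_eq_orbitalIntegral_descended νG (Subgroup.centralizer ({ε} : Set ((cmDatum L 3 H').Local v))) hMc (Measure.map e νH) (e (Quotient.out (ConjClasses.mk h)))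
    (hT := hTc) (hT' := hTMc)
    (Measure.map eT (Measure.map (subgroupCongrHomeomorph e (Subgroup.centralizer ({(Quotient.out (ConjClasses.mk h))} : Set ((cmDatum L 2 (Matrix.of fun i j : Fin 2 => if i.val + j.val + 1 = 2 then (1 : L) else 0)).Local v × (cmDatum L 1 (Matrix.of fun i j : Fin 1 => if i.val + j.val + 1 = 1 then (1 : L) else 0)).Local v))) (Subgroup.centralizer ({e (Quotient.out (ConjClasses.mk h))} : Set ↥(Subgroup.centralizer ({ε} : Set ((cmDatum L 3 H').Local v))))) hHH' he hes) tH))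
    (Measure.map (subgroupCongrHomeomorph e (Subgroup.centralizer ({(Quotient.out (ConjClasses.mk h))} : Set ((cmDatum L 2 (Matrix.of fun i j : Fin 2 => if i.val + j.val + 1 = 2 then (1 : L) else 0)).Local v × (cmDatum L 1 (Matrix.of fun i j : Fin 1 => if i.val + j.val + 1 = 1 then (1 : L) else 0)).Local v))) (Subgroup.centralizer ({e (Quotient.out (ConjClasses.mk h))} : Set ↥(Subgroup.centralizer ({ε} : Set ((cmDatum L 3 H').Local v))))) hHH' he hes) tH) rfl hO hβc hβs hβ0 hβ1 hψc hψs hCM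
  -- STEP D: transport along `θ : H_v ≃ M` (★ `integral_descConj_quotientMeasure_eq_of_mulEquiv`)
  haveI : IsClosed (((Subgroup.centralizer ({(Quotient.out (ConjClasses.mk h))} : Set ((cmDatum L 2 (Matrix.of fun i j : Fin 2 => if i.val + j.val + 1 = 2 then (1 : L) else 0)).Local v × (cmDatum L 1 (Matrix.of fun i j : Fin 1 => if i.val + j.val + 1 = 1 then (1 : L) else 0)).Local v))) : Subgroup ((cmDatum L 2 (Matrix.of fun i j : Fin 2 => if i.val + j.val + 1 = 2 then (1 : L) else 0)).Local v × (cmDatum L 1 (Matrix.of fun i j : Fin 1 => if i.val + j.val + 1 = 1 then (1 : L) else 0)).Local v)) : Set ((cmDatum L 2 (Matrix.of fun i j : Fin 2 => if i.val + j.val + 1 = 2 then (1 : L) else 0)).Local v × (cmDatum L 1 (Matrix.of fun i j : Fin 1 => if i.val + j.val + 1 = 1 then (1 : L) else 0)).Local v)) := hZHc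
  haveI : IsClosed (((Subgroup.centralizer ({e (Quotient.out (ConjClasses.mk h))} : Set ↥(Subgroup.centralizer ({ε} : Set ((cmDatum L 3 H').Local v))))) : Subgroup ↥(Subgroup.centralizer ({ε} : Set ((cmDatum L 3 H').Local v)))) : Set ↥(Subgroup.centralizer ({ε} : Set ((cmDatum L 3 H').Local v)))) := hTMc
  have hD' := integral_descConj_quotientMeasure_eq_of_mulEquiv e he hes (Subgroup.centralizer ({(Quotient.out (ConjClasses.mk h))} : Set ((cmDatum L 2 (Matrix.of fun i j : Fin 2 => if i.val + j.val + 1 = 2 then (1 : L) else 0)).Local v × (cmDatum L 1 (Matrix.of fun i j : Fin 1 => if i.val + j.val + 1 = 1 then (1 : L) else 0)).Local v))) (Subgroup.centralizer ({e (Quotient.out (ConjClasses.mk h))} : Set ↥(Subgroup.centralizer ({ε} : Set ((cmDatum L 3 H').Local v))))) hHH'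
    tH (Measure.map (subgroupCongrHomeomorph e (Subgroup.centralizer ({(Quotient.out (ConjClasses.mk h))} : Set ((cmDatum L 2 (Matrix.of fun i j : Fin 2 => if i.val + j.val + 1 = 2 then (1 : L) else 0)).Local v × (cmDatum L 1 (Matrix.of fun i j : Fin 1 => if i.val + j.val + 1 = 1 then (1 : L) else 0)).Local v))) (Subgroup.centralizer ({e (Quotient.out (ConjClasses.mk h))} : Set ↥(Subgroup.centralizer ({ε} : Set ((cmDatum L 3 H').Local v))))) hHH' he hes) tH) νH (Measure.map e νH) rfl rfl
    (rfl : e (Quotient.out (ConjClasses.mk h)) = e (Quotient.out (ConjClasses.mk h))) (fun _ hg => Subgroup.mem_centralizer_singleton_iff.1 hg)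
    (fun _ hg => Subgroup.mem_centralizer_singleton_iff.1 hg) (fun m : ↥(Subgroup.centralizer ({ε} : Set ((cmDatum L 3 H').Local v))) => ∫ x, β x • ψ (x * (m : ((cmDatum L 3 H').Local v)) * x⁻¹) ∂νG)
  -- STEP E: the right-hand side at the representative
  have hE : classOrbitalIntegral mH (fun z : ((cmDatum L 2 (Matrix.of fun i j : Fin 2 => if i.val + j.val + 1 = 2 then (1 : L) else 0)).Local v × (cmDatum L 1 (Matrix.of fun i j : Fin 1 => if i.val + j.val + 1 = 1 then (1 : L) else 0)).Local v) => ∫ x, β x • ψ (x * ((θ z : ↥(Subgroup.centralizer ({ε} : Set ((cmDatum L 3 H').Local v)))) : ((cmDatum L 3 H').Local v)) * x⁻¹) ∂νG) (ConjClasses.mk h) =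
      orbitalIntegral (Quotient.out (ConjClasses.mk h)) ((fun m : ↥(Subgroup.centralizer ({ε} : Set ((cmDatum L 3 H').Local v))) => ∫ x, β x • ψ (x * (m : ((cmDatum L 3 H').Local v)) * x⁻¹) ∂νG) ∘ e) (quotientMeasure (Subgroup.centralizer ({(Quotient.out (ConjClasses.mk h))} : Set ((cmDatum L 2 (Matrix.of fun i j : Fin 2 => if i.val + j.val + 1 = 2 then (1 : L) else 0)).Local v × (cmDatum L 1 (Matrix.of fun i j : Fin 1 => if i.val + j.val + 1 = 1 then (1 : L) else 0)).Local v))) tH hZHc νH) := by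
    rw [classOrbitalIntegral_eq, hmHc]
    congr 1
    funext z
    simp only [Function.comp_apply, heθ]
  -- assembly
  rw [hA, hB', hC', hE, orbitalIntegral_eq_integral_descConj, orbitalIntegral_eq_integral_descConj]
  exact hD'

end CentralSingularDescentWitness

end Summit.HodgeConjecture.HodgeConjecture.Cruxes.H413.K2E3GermConstantRegularHRDescentWitness

end
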